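import Literature.AlgebraicGeometry.AbelianSchemes.AbelianSchemeOverGlueDataOfTripleTransitions
import Literature.AlgebraicGeometry.AbelianSchemes.PolarizedAbelianSchemeWithLevelBaseChangeCancel
import HarnessLib

/-!
# The COCYCLE CONDITION of transition isomorphisms of triples is automatic (triple rigidity): gluing polarised triples
# from slice triples and pairwise transition relations alone (hand (h7), the F-8 (8c) entrance, second half)

Topic `AlgebraicGeometry/AbelianSchemes`; namespace `Literature.AlgebraicGeometry.AbelianSchemes.PolarizedAbelianSchemeWithLevel`.
Cell hodgecm-mathlib (D-0151), hand (h7)(D-F3); consumer F-8 (8c).  ★ FILE J `AbelianSchemeOverGlueDataOfTripleTransitions`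
glues slice TRIPLES `Pᵢ` over glue data `D` of the base along pairwise five-clause transition relations
`R i j : (Pᵢ|_{V(i,j)}).IsBaseChangeVia (Pⱼ|_{V(j,i)}) (D.t i j) (θ i j) (θ̂ i j)`, discharging `θᵢᵢ = 𝟙` by triple rigidity but
keeping the cocycle condition `hcoc` on triple overlaps (★ B-p04 `relativeT'` currency) as an input.  THIS FILE discharges
`hcoc` too ([MumfordFogartyKirwan1994, Ch. 7 §3, lemma of Serre]: level-`N` triples have no automorphisms, so transition
isomorphisms of triples satisfy the cocycle condition automatically — the sentence every gluing of universal families uses):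

* §1 the relative triple overlap `Tᵢ(j,k) = (Zᵢ ×_{Uᵢ} V(i,j)) ×_{Zᵢ} (Zᵢ ×_{Uᵢ} V(i,k))` of ★ `GlueDataRelative` IS the total
  space of the TRIPLE `Qᵢ(j,k) := (Pᵢ|_{V(i,j)})|_{V(i,j) ×_{Uᵢ} V(i,k)}` (★ `PolarizedAbelianSchemeWithLevel.baseChange` twice):
  `tripleOverlapIso : Tᵢ(j,k) ≅ Wᵢ(j,k)` (★ `isPullback_relativeToBase`, Mathlib `IsPullback.isoIsPullback`) and its four
  component identities;
* §2 the transition relation on triple overlaps: `Qᵢ(j,k)` is a pull-back of `Pⱼ` along `D.t' i j k ≫ (V(j,k) ×_{Uⱼ} V(j,i) → Uⱼ)`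
  (`R i j` composed with the base-change relations, Mathlib `Scheme.GlueData.t_fac`), `Qⱼ(k,i)` one along the second map;
  ★ K1 `exists_isBaseChangeVia_of_comp` CANCELS them to a relation `Qᵢ(j,k) → Qⱼ(k,i)` along `D.t' i j k` whose
  `A`-component, conjugated by `tripleOverlapIso`, IS `relativeT' i j k` (★ `relativeT'_unique`):
  `relativeT'_eq_conj`;
* §3 **`relativeT'_cocycle`** — the cocycle composite is conjugate to the `A`-component of a self-relation of `Qᵢ(j,k)`
  along `t' i j k ≫ t' j k i ≫ t' k i j = 𝟙` (Mathlib `Scheme.GlueData.cocycle`), hence the identity by ★ (L1)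
  `eq_id_of_isBaseChangeVia_id_of_forall_geometricPoint` (under its field-level hypothesis `hΩ`);
  **`glueTripleOfTransitions`** / **`isBaseChangeVia_glueTripleOfTransitions`** — ★ FILE J with `hcoc` discharged:
  the glued `PolarizedAbelianSchemeWithLevel g N δ D.glued` with cartesian charts from slice triples, pairwise transition
  relations, `hΩ` and ANY dual pair of the glued family — nothing else.

HC_CM is proved only modulo the printed citations until rung 0 closes; this file discharges none of them.

## References
* [MumfordFogartyKirwan1994] D. Mumford, J. Fogarty, F. Kirwan, *Geometric Invariant Theory*, 3rd ed. (1994), Ch. 7 §2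
  Def. 7.2 (p. 129), Def. 7.3 (p. 129); §3, remark after Thm. 7.9 (p. 139) (lemma of Serre).
* [StacksProject] The Stacks Project, Tag 01LH (Relative glueing), Tag 01JA (Glueing schemes).
* [GortzWedhorn2020] U. Görtz, T. Wedhorn, *Algebraic Geometry I*, 2nd ed. (2020), Prop. 4.16 (p. 101), Section (4.8) Lemma 4.28.
-/

universe u

open CategoryTheory CategoryTheory.Limits AlgebraicGeometry MonoidalCategory
open Literature.AlgebraicGeometry.Morphisms

noncomputable section

namespace Literature.AlgebraicGeometry.AbelianSchemes

namespace PolarizedAbelianSchemeWithLevel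

open AbelianSchemeOver
open Literature.AlgebraicGeometry.ModuliOfAbelianVarieties (IsPolarizationType)
open scoped MonObj

variable {g N : ℕ} {δ : Fin g → ℕ} {D : Scheme.GlueData.{u}}
  (P : ∀ i : D.J, PolarizedAbelianSchemeWithLevel g N δ (D.U i))

/-! ### §1 The relative triple overlap is the total space of the twice base-changed triple -/

section Overlap

variable (i j k : D.J)

/-- The total space `Wᵢ(j,k)` of `Qᵢ(j,k) = (Pᵢ|_{V(i,j)})|_{V(i,j) ×_{Uᵢ} V(i,k)}` is cartesian over `Zᵢ → Uᵢ` along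
`V(i,j) ×_{Uᵢ} V(i,k) → Uᵢ` (two pull-back squares pasted). [cite: GortzWedhorn2020, Section (4.8) Lemma 4.28] -/
theorem isPullback_baseChange_baseChange :
    IsPullback
      (pullback.fst (pullback.snd (P i).A.X.hom (D.f i j)) (pullback.fst (D.f i j) (D.f i k)) ≫
        pullback.fst (P i).A.X.hom (D.f i j))
      (pullback.snd (pullback.snd (P i).A.X.hom (D.f i j)) (pullback.fst (D.f i j) (D.f i k))) (P i).A.X.hom
      (pullback.fst (D.f i j) (D.f i k) ≫ D.f i j) :=
  (IsPullback.of_hasPullback (pullback.snd (P i).A.X.hom (D.f i j)) (pullback.fst (D.f i j) (D.f i k))).paste_horiz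
    (IsPullback.of_hasPullback (P i).A.X.hom (D.f i j))

/-- **`Tᵢ(j,k) ≅ Wᵢ(j,k)`**: the relative triple overlap of ★ `GlueDataRelative` and the total space of `Qᵢ(j,k)` are both
`Zᵢ ×_{Uᵢ} (V(i,j) ×_{Uᵢ} V(i,k))` (★ `isPullback_relativeToBase`, Mathlib `IsPullback.isoIsPullback`).
[cite: StacksProject, Tag 01LH] [cite: GortzWedhorn2020, Section (4.8) Lemma 4.28] -/
def tripleOverlapIso :
    pullback (pullback.fst (P i).A.X.hom (D.f i j)) (pullback.fst (P i).A.X.hom (D.f i k)) ≅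
      pullback (pullback.snd (P i).A.X.hom (D.f i j)) (pullback.fst (D.f i j) (D.f i k)) :=
  (isPullback_relativeToBase D (fun i => (P i).A.X.left) (fun i => (P i).A.X.hom) i j k).isoIsPullback _ _
    (isPullback_baseChange_baseChange P i j k)

/-- `ω ≫ (W → Zᵢ) = (T → Zᵢ)`. [cite: StacksProject, Tag 01LH] -/
theorem tripleOverlapIso_hom_fst_fst :
    (tripleOverlapIso P i j k).hom ≫ pullback.fst _ _ ≫ pullback.fst (P i).A.X.hom (D.f i j) =
      pullback.fst _ _ ≫ pullback.fst (P i).A.X.hom (D.f i j) :=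
  (isPullback_relativeToBase D (fun i => (P i).A.X.left) (fun i => (P i).A.X.hom) i j k).isoIsPullback_hom_fst _ _
    (isPullback_baseChange_baseChange P i j k)

/-- `ω ≫ (W → B) = relativeToBase`. [cite: StacksProject, Tag 01LH] -/
theorem tripleOverlapIso_hom_snd :
    (tripleOverlapIso P i j k).hom ≫ pullback.snd _ _ =
      relativeToBase D (fun i => (P i).A.X.left) (fun i => (P i).A.X.hom) i j k :=
  (isPullback_relativeToBase D (fun i => (P i).A.X.left) (fun i => (P i).A.X.hom) i j k).isoIsPullback_hom_snd _ _
    (isPullback_baseChange_baseChange P i j k)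

/-- `ω⁻¹ ≫ (T → Zᵢ) = (W → Zᵢ)`. [cite: StacksProject, Tag 01LH] -/
theorem tripleOverlapIso_inv_fst_fst :
    (tripleOverlapIso P i j k).inv ≫ pullback.fst _ _ ≫ pullback.fst (P i).A.X.hom (D.f i j) =
      pullback.fst _ _ ≫ pullback.fst (P i).A.X.hom (D.f i j) :=
  (isPullback_relativeToBase D (fun i => (P i).A.X.left) (fun i => (P i).A.X.hom) i j k).isoIsPullback_inv_fst _ _
    (isPullback_baseChange_baseChange P i j k)

/-- `ω⁻¹ ≫ relativeToBase = (W → B)`. [cite: StacksProject, Tag 01LH] -/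
theorem tripleOverlapIso_inv_relativeToBase :
    (tripleOverlapIso P i j k).inv ≫ relativeToBase D (fun i => (P i).A.X.left) (fun i => (P i).A.X.hom) i j k =
      pullback.snd _ _ :=
  (isPullback_relativeToBase D (fun i => (P i).A.X.left) (fun i => (P i).A.X.hom) i j k).isoIsPullback_inv_snd _ _
    (isPullback_baseChange_baseChange P i j k)

/-- **`ω` followed by the projection `W → Zᵢ ×_{Uᵢ} V(i,j)` is the projection `T → Zᵢ ×_{Uᵢ} V(i,j)`** (components: in `Zᵢ`
by `tripleOverlapIso_hom_fst_fst`, in `V(i,j)` via `relativeToBase_fst`). [cite: StacksProject, Tag 01LH] -/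
theorem tripleOverlapIso_hom_fst :
    (tripleOverlapIso P i j k).hom ≫ pullback.fst _ _ =
      pullback.fst (pullback.fst (P i).A.X.hom (D.f i j)) (pullback.fst (P i).A.X.hom (D.f i k)) := by
  apply pullback.hom_ext
  · exact (Category.assoc _ _ _).trans (tripleOverlapIso_hom_fst_fst P i j k)
  · have hc : pullback.fst (pullback.snd (P i).A.X.hom (D.f i j)) (pullback.fst (D.f i j) (D.f i k)) ≫
        pullback.snd (P i).A.X.hom (D.f i j) =
        pullback.snd (pullback.snd (P i).A.X.hom (D.f i j)) (pullback.fst (D.f i j) (D.f i k)) ≫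
          pullback.fst (D.f i j) (D.f i k) := pullback.condition
    exact (Category.assoc _ _ _).trans ((congrArg ((tripleOverlapIso P i j k).hom ≫ ·) hc).trans
      ((Category.assoc _ _ _).symm.trans ((congrArg (· ≫ pullback.fst (D.f i j) (D.f i k))
        (tripleOverlapIso_hom_snd P i j k)).trans
          (relativeToBase_fst D (fun i => (P i).A.X.left) (fun i => (P i).A.X.hom) i j k))))

end Overlap

/-! ### §2 The transition relation on triple overlaps and `relativeT'` -/

section Transition

variable (θ : ∀ i j, pullback (P i).A.X.hom (D.f i j) ⟶ pullback (P j).A.X.hom (D.f j i))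
  (θhat : ∀ i j, ((P i).D.baseChange (D.f i j)).hat.X.left ⟶ ((P j).D.baseChange (D.f j i)).hat.X.left)
  (R : ∀ i j, ((P i).baseChange (D.f i j)).IsBaseChangeVia ((P j).baseChange (D.f j i)) (D.t i j) (θ i j) (θhat i j))
  (i j k : D.J)

/-- The base maps agree: `(pr₁ ≫ D.t i j) ≫ D.f j i = D.t' i j k ≫ (pr₁ ≫ D.f j k)` on `V(i,j) ×_{Uᵢ} V(i,k)` (Mathlib
`Scheme.GlueData.t_fac`, `pullback.condition`). [cite: StacksProject, Tag 01JA] -/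
theorem base_eq : (pullback.fst (D.f i j) (D.f i k) ≫ D.t i j) ≫ D.f j i =
    D.t' i j k ≫ pullback.fst (D.f j k) (D.f j i) ≫ D.f j k := by
  rw [pullback.condition, ← Category.assoc, D.t_fac, Category.assoc]

include R in
/-- **`Qᵢ(j,k)` is a pull-back of `Pⱼ` along `D.t' i j k ≫ (V(j,k) ×_{Uⱼ} V(j,i) → Uⱼ)`** via `pr ≫ θ i j ≫ pr_{Zⱼ}`: the base-change
relation to `Pᵢ|_{V(i,j)}`, then `R i j`, then the base-change relation `Pⱼ|_{V(j,i)} → Pⱼ` (★ `IsBaseChangeVia.trans`), base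
maps aligned by `base_eq`. [cite: MumfordFogartyKirwan1994, Ch. 7 §2 Definition 7.2 (p. 129)] -/
theorem isBaseChangeVia_overlap_fst :
    (((P i).baseChange (D.f i j)).baseChange (pullback.fst (D.f i j) (D.f i k))).IsBaseChangeVia (P j)
      (D.t' i j k ≫ pullback.fst (D.f j k) (D.f j i) ≫ D.f j k)
      ((pullback.fst _ _ ≫ θ i j) ≫ pullback.fst (P j).A.X.hom (D.f j i))
      ((pullback.fst _ _ ≫ θhat i j) ≫ pullback.fst (P j).D.hat.X.hom (D.f j i)) := by
  have h := ((((P i).baseChange (D.f i j)).baseChange_isBaseChangeVia (pullback.fst (D.f i j) (D.f i k))).trans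
    (R i j)).trans ((P j).baseChange_isBaseChangeVia (D.f j i))
  exact (congrArg (fun x => (((P i).baseChange (D.f i j)).baseChange (pullback.fst (D.f i j) (D.f i k))).IsBaseChangeVia
    (P j) x ((pullback.fst _ _ ≫ θ i j) ≫ pullback.fst (P j).A.X.hom (D.f j i))
      ((pullback.fst _ _ ≫ θhat i j) ≫ pullback.fst (P j).D.hat.X.hom (D.f j i))) (base_eq i j k)).mp h

/-- **`Qⱼ(k,i)` is a pull-back of `Pⱼ` along `V(j,k) ×_{Uⱼ} V(j,i) → Uⱼ`** via the projections (two base-change relations).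
[cite: MumfordFogartyKirwan1994, Ch. 7 §2 Definition 7.2 (p. 129)] -/
theorem isBaseChangeVia_overlap_snd :
    (((P j).baseChange (D.f j k)).baseChange (pullback.fst (D.f j k) (D.f j i))).IsBaseChangeVia (P j)
      (pullback.fst (D.f j k) (D.f j i) ≫ D.f j k)
      (pullback.fst _ _ ≫ pullback.fst (P j).A.X.hom (D.f j k))
      (pullback.fst _ _ ≫ pullback.fst (P j).D.hat.X.hom (D.f j k)) :=
  (((P j).baseChange (D.f j k)).baseChange_isBaseChangeVia (pullback.fst (D.f j k) (D.f j i))).trans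
    ((P j).baseChange_isBaseChangeVia (D.f j k))

include R in
/-- **The transition relation on triple overlaps** `Qᵢ(j,k) → Qⱼ(k,i)` along `D.t' i j k` (★ K1
`exists_isBaseChangeVia_of_comp` cancelling §2's two relations into `Pⱼ`), with the two defining equations of its
`A`-component `m`. [cite: MumfordFogartyKirwan1994, Ch. 7 §2 Definition 7.2 (p. 129)] [cite: GortzWedhorn2020, Prop. 4.16 (p. 101)] -/
theorem exists_transition :
    ∃ (m : pullback (pullback.snd (P i).A.X.hom (D.f i j)) (pullback.fst (D.f i j) (D.f i k)) ⟶
        pullback (pullback.snd (P j).A.X.hom (D.f j k)) (pullback.fst (D.f j k) (D.f j i)))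
      (mh : (((P i).baseChange (D.f i j)).baseChange (pullback.fst (D.f i j) (D.f i k))).D.hat.X.left ⟶
        (((P j).baseChange (D.f j k)).baseChange (pullback.fst (D.f j k) (D.f j i))).D.hat.X.left),
      m ≫ (pullback.fst _ _ ≫ pullback.fst (P j).A.X.hom (D.f j k)) =
          (pullback.fst _ _ ≫ θ i j) ≫ pullback.fst (P j).A.X.hom (D.f j i) ∧
        (((P i).baseChange (D.f i j)).baseChange (pullback.fst (D.f i j) (D.f i k))).IsBaseChangeVia
          (((P j).baseChange (D.f j k)).baseChange (pullback.fst (D.f j k) (D.f j i))) (D.t' i j k) m mh := by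
  obtain ⟨m, mh, hmG, -, h⟩ := exists_isBaseChangeVia_of_comp (isBaseChangeVia_overlap_fst P θ θhat R i j k)
    (isBaseChangeVia_overlap_snd P i j k)
  exact ⟨m, mh, hmG, h⟩

include R in
/-- **`relativeT' i j k` is the transition relation's `A`-component conjugated by the overlap isomorphisms**:
`relativeT' i j k = ω ≫ m ≫ ω⁻¹` for every `m` as in `exists_transition` (★ `relativeT'_unique`: both lie over `θ i j`, i.e.
have the same `Zⱼ`- and `V(j,i)`-components). [cite: StacksProject, Tag 01LH] [cite: MumfordFogartyKirwan1994, Ch. 7 §2 Definition 7.2 (p. 129)] -/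
theorem relativeT'_eq_conj
    (m : pullback (pullback.snd (P i).A.X.hom (D.f i j)) (pullback.fst (D.f i j) (D.f i k)) ⟶
      pullback (pullback.snd (P j).A.X.hom (D.f j k)) (pullback.fst (D.f j k) (D.f j i)))
    (hmG : m ≫ (pullback.fst _ _ ≫ pullback.fst (P j).A.X.hom (D.f j k)) =
      (pullback.fst _ _ ≫ θ i j) ≫ pullback.fst (P j).A.X.hom (D.f j i))
    (hmπ : m ≫ pullback.snd _ _ = pullback.snd _ _ ≫ D.t' i j k) :
    relativeT' D (fun i => (P i).A.X.left) (fun i => (P i).A.X.hom) θ (fun i j => (R i j).1.1.fst) i j k =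
      (tripleOverlapIso P i j k).hom ≫ m ≫ (tripleOverlapIso P j k i).inv := by
  symm
  refine relativeT'_unique D (fun i => (P i).A.X.left) (fun i => (P i).A.X.hom) θ (fun i j => (R i j).1.1.fst) i j k _ ?_
  -- both sides into `Zⱼ ×_{Uⱼ} V(j,i)`: compare the `Zⱼ`- and the `V(j,i)`-components
  have hθ : θ i j ≫ pullback.snd (P j).A.X.hom (D.f j i) = pullback.snd (P i).A.X.hom (D.f i j) ≫ D.t i j :=
    (R i j).1.1.fst
  -- `pullback.snd` of `Tⱼ(k,i)` into `Zⱼ ×_{Uⱼ} V(j,i)`: its `Zⱼ`-component is `pr ≫ pr` (pullback.condition of `Tⱼ(k,i)`)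
  have hT : pullback.snd (pullback.fst (P j).A.X.hom (D.f j k)) (pullback.fst (P j).A.X.hom (D.f j i)) ≫
      pullback.fst (P j).A.X.hom (D.f j i) =
      pullback.fst (pullback.fst (P j).A.X.hom (D.f j k)) (pullback.fst (P j).A.X.hom (D.f j i)) ≫
        pullback.fst (P j).A.X.hom (D.f j k) := pullback.condition.symm
  apply pullback.hom_ext
  · -- `Zⱼ`-components
    have l : (((tripleOverlapIso P i j k).hom ≫ m ≫ (tripleOverlapIso P j k i).inv) ≫ pullback.snd _ _) ≫
        pullback.fst (P j).A.X.hom (D.f j i) =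
        (tripleOverlapIso P i j k).hom ≫ m ≫ pullback.fst _ _ ≫ pullback.fst (P j).A.X.hom (D.f j k) := by
      rw [Category.assoc, hT, Category.assoc, Category.assoc, tripleOverlapIso_inv_fst_fst]
    refine l.trans ((congrArg ((tripleOverlapIso P i j k).hom ≫ ·) hmG).trans ?_)
    rw [← Category.assoc, ← Category.assoc, tripleOverlapIso_hom_fst]
  · -- `V(j,i)`-components: through the base triple overlaps and `t_fac`
    have hsnd : pullback.snd (pullback.fst (P j).A.X.hom (D.f j k)) (pullback.fst (P j).A.X.hom (D.f j i)) ≫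
        pullback.snd (P j).A.X.hom (D.f j i) =
        relativeToBase D (fun i => (P i).A.X.left) (fun i => (P i).A.X.hom) j k i ≫ pullback.snd (D.f j k) (D.f j i) :=
      (relativeToBase_snd D (fun i => (P i).A.X.left) (fun i => (P i).A.X.hom) j k i).symm
    have hfst : pullback.fst (pullback.fst (P i).A.X.hom (D.f i j)) (pullback.fst (P i).A.X.hom (D.f i k)) ≫
        pullback.snd (P i).A.X.hom (D.f i j) =
        relativeToBase D (fun i => (P i).A.X.left) (fun i => (P i).A.X.hom) i j k ≫ pullback.fst (D.f i j) (D.f i k) :=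
      (relativeToBase_fst D (fun i => (P i).A.X.left) (fun i => (P i).A.X.hom) i j k).symm
    rw [Category.assoc, Category.assoc, Category.assoc, hsnd, ← Category.assoc (tripleOverlapIso P j k i).inv,
      tripleOverlapIso_inv_relativeToBase, ← Category.assoc m, hmπ, Category.assoc, D.t_fac,
      ← Category.assoc (tripleOverlapIso P i j k).hom, tripleOverlapIso_hom_snd, Category.assoc, hθ]
    exact ((congrArg (· ≫ D.t i j) hfst).symm).trans (Category.assoc _ _ _)

end Transition

/-! ### §3 The cocycle condition, and gluing from transition relations alone -/

section Cocycle

variable (θ : ∀ i j, pullback (P i).A.X.hom (D.f i j) ⟶ pullback (P j).A.X.hom (D.f j i))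
  (θhat : ∀ i j, ((P i).D.baseChange (D.f i j)).hat.X.left ⟶ ((P j).D.baseChange (D.f j i)).hat.X.left)
  (R : ∀ i j, ((P i).baseChange (D.f i j)).IsBaseChangeVia ((P j).baseChange (D.f j i)) (D.t i j) (θ i j) (θhat i j))
  (hΩ : ∀ ⦃Ω : Type u⦄ [Field Ω] [IsAlgClosed Ω] (Q : PolarizedAbelianSchemeWithLevel g N δ (Spec (.of Ω)))
    (H : Q.A.X.left ⟶ Q.A.X.left) (Ĥ : Q.D.hat.X.left ⟶ Q.D.hat.X.left), Q.IsBaseChangeVia Q (𝟙 _) H Ĥ → H = 𝟙 _)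

include R hΩ in
/-- **THE COCYCLE CONDITION IS AUTOMATIC**: on the relative triple overlap `Tᵢ(j,k)`,
`relativeT' i j k ≫ relativeT' j k i ≫ relativeT' k i j = 𝟙` — conjugate by `tripleOverlapIso` (§2 `relativeT'_eq_conj`)
to the `A`-component `m₁ ≫ m₂ ≫ m₃` of a SELF-relation of the triple `Qᵢ(j,k)` along
`D.t' i j k ≫ D.t' j k i ≫ D.t' k i j = 𝟙` (★ `IsBaseChangeVia.trans`, Mathlib `Scheme.GlueData.cocycle`), which is the
identity by triple rigidity (★ `eq_id_of_isBaseChangeVia_id_of_forall_geometricPoint` under `hΩ`, over the locally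
Noetherian `V(i,j) ×_{Uᵢ} V(i,k)`). [cite: MumfordFogartyKirwan1994, Ch. 7 §3, remark after Theorem 7.9 (p. 139) («lemma of Serre»)]
[cite: StacksProject, Tag 01LH] [cite: MumfordFogartyKirwan1994, Ch. 7 §2 Definition 7.2 (p. 129)] -/
theorem relativeT'_cocycle [∀ i, IsLocallyNoetherian (D.U i)] (i j k : D.J) :
    relativeT' D (fun i => (P i).A.X.left) (fun i => (P i).A.X.hom) θ (fun i j => (R i j).1.1.fst) i j k ≫
      relativeT' D (fun i => (P i).A.X.left) (fun i => (P i).A.X.hom) θ (fun i j => (R i j).1.1.fst) j k i ≫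
        relativeT' D (fun i => (P i).A.X.left) (fun i => (P i).A.X.hom) θ (fun i j => (R i j).1.1.fst) k i j = 𝟙 _ := by
  obtain ⟨m₁, mh₁, hm₁G, r₁⟩ := exists_transition P θ θhat R i j k
  obtain ⟨m₂, mh₂, hm₂G, r₂⟩ := exists_transition P θ θhat R j k i
  obtain ⟨m₃, mh₃, hm₃G, r₃⟩ := exists_transition P θ θhat R k i j
  rw [relativeT'_eq_conj P θ θhat R i j k m₁ hm₁G r₁.1.1.fst, relativeT'_eq_conj P θ θhat R j k i m₂ hm₂G r₂.1.1.fst,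
    relativeT'_eq_conj P θ θhat R k i j m₃ hm₃G r₃.1.1.fst]
  -- the self-relation of `Qᵢ(j,k)` along `t' ≫ t' ≫ t' = 𝟙`
  have r := (r₁.trans r₂).trans r₃
  have hbase : (D.t' i j k ≫ D.t' j k i) ≫ D.t' k i j = 𝟙 _ := (Category.assoc _ _ _).trans (D.cocycle i j k)
  have r' : (((P i).baseChange (D.f i j)).baseChange (pullback.fst (D.f i j) (D.f i k))).IsBaseChangeVia
      (((P i).baseChange (D.f i j)).baseChange (pullback.fst (D.f i j) (D.f i k))) (𝟙 _) ((m₁ ≫ m₂) ≫ m₃)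
      ((mh₁ ≫ mh₂) ≫ mh₃) :=
    (congrArg (fun x => (((P i).baseChange (D.f i j)).baseChange (pullback.fst (D.f i j) (D.f i k))).IsBaseChangeVia
      (((P i).baseChange (D.f i j)).baseChange (pullback.fst (D.f i j) (D.f i k))) x ((m₁ ≫ m₂) ≫ m₃)
      ((mh₁ ≫ mh₂) ≫ mh₃)) hbase).mp r
  haveI : IsLocallyNoetherian (pullback (D.f i j) (D.f i k)) :=
    isLocallyNoetherian_of_isOpenImmersion (pullback.fst (D.f i j) (D.f i k) ≫ D.f i j)
  have hid : (m₁ ≫ m₂) ≫ m₃ = 𝟙 _ :=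
    (((P i).baseChange (D.f i j)).baseChange (pullback.fst (D.f i j) (D.f i k))).eq_id_of_isBaseChangeVia_id_of_forall_geometricPoint
      (fun Ω _ _ _ => @hΩ Ω _ _) r'
  have hid' : m₁ ≫ m₂ ≫ m₃ = 𝟙 _ := (Category.assoc _ _ _).symm.trans hid
  simp only [Category.assoc, Iso.inv_hom_id_assoc]
  rw [reassoc_of% hid', Iso.hom_inv_id]

include R hΩ in
/-- The cocycle condition in the exact binder form of ★ FILE J (`cocycleDatumOfTriples`/`glueTripleOfTriples`).
[cite: StacksProject, Tag 01LH] -/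
theorem hcoc_of_transitions [∀ i, IsLocallyNoetherian (D.U i)] :
    ∀ i j k, relativeT' D (fun i => (P i).A.X.left) (fun i => (P i).A.X.hom) θ (fun i j => (R i j).1.1.fst) i j k ≫
      relativeT' D (fun i => (P i).A.X.left) (fun i => (P i).A.X.hom) θ (fun i j => (R i j).1.1.fst) j k i ≫
        relativeT' D (fun i => (P i).A.X.left) (fun i => (P i).A.X.hom) θ (fun i j => (R i j).1.1.fst) k i j = 𝟙 _ :=
  fun i j k => relativeT'_cocycle P θ θhat R hΩ i j k

variable [∀ i, IsLocallyNoetherian (D.U i)] [∀ i, IsReduced (D.U i)]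
  (D₀ : (cocycleDatumOfTriples P θ θhat R hΩ (hcoc_of_transitions P θ θhat R hΩ)).abelianScheme.DualPair)
  (hδ : IsPolarizationType δ)

/-- **GLUING FROM SLICE TRIPLES AND TRANSITION RELATIONS ALONE**: the glued triple over `A⁰ = D.glued` from slice triples
`Pᵢ`, pairwise five-clause transition relations `R i j`, the field-level rigidity hypothesis `hΩ` and ANY dual pair `D₀` of
the glued family, over reduced locally Noetherian slices (★ FILE J `glueTripleOfTriples` with `hcoc` discharged by §3).
[cite: MumfordFogartyKirwan1994, Ch. 7 §2 Definition 7.2 (p. 129)] [cite: StacksProject, Tag 01LH] -/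
def glueTripleOfTransitions : PolarizedAbelianSchemeWithLevel g N δ D.glued :=
  glueTripleOfTriples P θ θhat R hΩ (hcoc_of_transitions P θ θhat R hΩ) D₀ hδ

/-- The abelian scheme of the glued triple is the glued family (definitional). [cite: StacksProject, Tag 01LH] -/
theorem glueTripleOfTransitions_A :
    (glueTripleOfTransitions P θ θhat R hΩ D₀ hδ).A =
      (cocycleDatumOfTriples P θ θhat R hΩ (hcoc_of_transitions P θ θhat R hΩ)).abelianScheme := rfl

/-- **CARTESIAN CHARTS**: every slice triple `Pᵢ` is the pull-back of `glueTripleOfTransitions` along `Uᵢ ↪ A⁰` (all five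
clauses; ★ FILE J `isBaseChangeVia_glueTripleOfTriples`). [cite: MumfordFogartyKirwan1994, Ch. 7 §2 Definition 7.2 (p. 129)]
[cite: StacksProject, Tag 01LH] -/
theorem isBaseChangeVia_glueTripleOfTransitions (i : D.J) :
    (P i).IsBaseChangeVia (glueTripleOfTransitions P θ θhat R hΩ D₀ hδ) (D.ι i)
      ((cocycleDatumOfTriples P θ θhat R hΩ (hcoc_of_transitions P θ θhat R hΩ)).total.ι i)
      ((cocycleDatumOfTriples P θ θhat R hΩ (hcoc_of_transitions P θ θhat R hΩ)).Ĝ (fun i => (P i).D)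
        (fun i => (P i).pol) θhat (fun i j => (R i j).2.2.1) (fun i j => (R i j).2.2.2) D₀.normalize i) :=
  isBaseChangeVia_glueTripleOfTriples P θ θhat R hΩ (hcoc_of_transitions P θ θhat R hΩ) D₀ hδ i

end Cocycle

end PolarizedAbelianSchemeWithLevel

end Literature.AlgebraicGeometry.AbelianSchemes

end
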